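import Literature.AnabelianGeometry.EtaleTheta.ThetaSystemsInvToyIso
import HarnessLib

/-!
# The tower form of [EtTh] Cor. 2.19 (ii) ("Discrete Rigidity") is a SCHEMA: its universal closure over
# the interface `ThetaEnvTower E` is FALSE — kernel witness (part 3 of 3)

Continuation of `ThetaSystemsInvToyTower.lean` / `ThetaSystemsInvToyIso.lean` (cell `abc-iut`; see the
module docstring of part 1 for the mathematics and the honest framing).  S. Mochizuki, *The Étale Theta
Function …* [EtTh], Publ. RIMS 45 (2009), §2, Cor. 2.19 (ii) p.64 ("any projective system of mono-theta
environments is isomorphic to the natural one"), proof p.66 ("the `R¹lim`'s … vanish"), Rmk. 2.16.1 (iii)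
p.56 (`R¹lim {N·l·ℤ} ≠ 0`).

THE ARGUMENT (`InvToy.not_cor219_ii`).  Let `x = (x_M)_M` be a compatible family of residues that is not
integral (`ThetaEnvTower.exists_compatible_family_not_integral`, PROVED in `ThetaSystems.lean`) and `S` the
twisted system of part 2.  Suppose `(α_M ∈ Aut(M_M))_M` straightens `S` (`Cor219_ii`).  Write
`α_M(s^alg(0,1,0)) = (σ_M, (0, p_M, r_M))`.
1. Compatibility with the twisted transitions gives `p_{M} = p` constant and
   `r_M = r_{M'} + (k_M - k_{M'})·p` (`pOf_rOf_of_compat`).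
2. At each level (`two_mul_rOf_of_iso`): the cyclotome `μ_M ⊆ Π^tp_Y[μ_M]` is characteristic
   (`Π^tp_Y = ℤ²` is torsion-free), `s^alg(0,1,0)` inverts `μ_M`, hence so does its image, which acts through
   `χ_M(p_M) = inv^{p_M}` — so `p_M` is odd unless `M ∣ 2`; then the `μ_M`-component of
   `α_M(s^alg(0,1,0))²` is `σ_M σ_M⁻¹ = 1`, while `α_M` stabilises `Im(s^Θ) ∋ s^alg(0,2,0) = s^alg(0,1,0)²`
   (`η_M(0,2,0) = 0`), which makes that component `-η_M(0, 2p, 2r_M) = -2r_M`.  Hence `M ∣ 2 r_M`.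
3. With `k` the integer lifts of `x`: `2p · x_M = 2p·k_1 - 2r_1 =: n` in `ℤ/M` for every `M ∈ E`, `2p ≠ 0`;
   over a cofinal `E` this forces `x` to be integral (`integral_of_mul_eq`) — contradiction.

| FACT row | decl | witness |
|---|---|---|
| F-0649 | `ThetaEnvTower.Cor219_ii` | `InvToy.not_forall_cor219_ii` (twisted system over a non-integral `l·Ẑ`-family) |

What a refutation here MEANS: only the logical shape of the interface row (consumable AT THE MODEL TOWER
by name — `cor219_ii_of_levels`, `DoubleUnderline.cor219_ii_model_of_facts` — never as `∀ T`); nothing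
about [EtTh], where Cor. 2.18 (iv) makes the automorphism towers Mittag-Leffler.  Seat abc-iut-w5-d071
(F-TRANCHES 154 of D-0078 (S1), row F-0649, float after abc-iut-f-154's census 2026-08-26).  No bearing on
[IUTchIII] Cor. 3.12; no side taken; typed ≠ proved.  No instances, no notation.

## References

* [MochizukiEtTh2009] S. Mochizuki, *The étale theta function and its Frobenioid-theoretic
  manifestations*, Publ. RIMS 45 (2009): Def. 2.13 pp.47–48, Rmk. 2.16.1 (iii) p.56, Cor. 2.18 (iv)
  pp.61–63, Cor. 2.19 (ii) p.64, proof p.66 (PRIMS text pages).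
-/

namespace Literature.AnabelianGeometry.EtaleTheta

namespace ThetaEnvTower

namespace InvToy

open Toy CycEnvelope

variable {E : Set ℕ+} (h1 : (1 : ℕ+) ∈ E) (hcof : ∀ n : ℕ+, ∃ M ∈ E, n ∣ M)
  (htot : ∀ M ∈ E, ∀ M' ∈ E, M ∣ M' ∨ M' ∣ M)

/-! ## §8. Reductions and coordinates -/

/-- The reduction `Π^tp_Y[μ_{M'}] → Π^tp_Y[μ_M]` is the identity on the tautological section.
[cite: MochizukiEtTh2009, Def 2.13(ii) p.48] -/
theorem redEnv_inr (T : ThetaEnvTower.{0} E) (M M' : E) (h : (M : ℕ+) ∣ M') (g : T.PiY) :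
    T.redEnv M M' h (SemidirectProduct.inr g) = SemidirectProduct.inr g := by
  unfold ThetaEnvTower.redEnv
  rw [SemidirectProduct.map_inr, MonoidHom.id_apply]

/-- The reduction is the identity on `Π^tp_Y`. [cite: MochizukiEtTh2009, Def 2.13(ii) p.48] -/
theorem redEnv_right (T : ThetaEnvTower.{0} E) (M M' : E) (h : (M : ℕ+) ∣ M') (y : (T.level M').env) :
    (T.redEnv M M' h y).right = y.right := rfl

/-- The probe `y = (0, 1, 0) ∈ Π^tp_Y`. [cite: MochizukiEtTh2009, Cor 2.19(ii) p.64] -/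
def yv : PiY0 := ⟨(1, (Multiplicative.ofAdd (1 : ℤ), 1)), rfl⟩

/-- The probe `(0, 2, 0) ∈ Π^tp_Ÿ`. [cite: MochizukiEtTh2009, Cor 2.19(ii) p.64] -/
def ydd2 : PiYdd0 := ⟨(1, (Multiplicative.ofAdd (2 : ℤ), 1)), two_mem_PiYdd0⟩

/-- The reductions of the toy fix the probe `s^alg(0,1,0)`. [cite: MochizukiEtTh2009, Def 2.13(ii) p.48] -/
theorem redEnv_inr_yv (M M' : E) (h : (M : ℕ+) ∣ M') :
    (toy h1 hcof htot).redEnv M M' h (SemidirectProduct.inr yv) = SemidirectProduct.inr yv :=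
  redEnv_inr (toy h1 hcof htot) M M' h yv

/-- Conjugating the cyclotome by an element of `Π^tp_Y[μ_n]` acts through `χ_n` of its `y`-coordinate.
[cite: MochizukiEtTh2009, Def 2.10 p.44] -/
theorem conj_inMu (n : ℕ+) (w : Env n) (b : Mu n) :
    w * inMu augY0 (chi n) b * w⁻¹ = inMu augY0 (chi n) (chi n (py (w.right : P)) b) := by
  refine SemidirectProduct.ext ?_ ?_
  · rw [SemidirectProduct.mul_left, SemidirectProduct.mul_left, SemidirectProduct.inv_left,
      SemidirectProduct.mul_right, SemidirectProduct.left_inl, SemidirectProduct.right_inl, mul_one,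
      ← MulAut.mul_apply, ← map_mul, mul_inv_cancel, map_one, MulAut.one_apply, mul_inv_cancel_comm]
    rfl
  · rw [SemidirectProduct.mul_right, SemidirectProduct.mul_right, SemidirectProduct.inv_right,
      SemidirectProduct.right_inl, mul_one, mul_inv_cancel]
    rfl

section Extraction

variable (α : ∀ M : E, MulAut ((toy h1 hcof htot).level M).env)

/-- The `y`-coordinate `p_M` of `α_M(s^alg(0,1,0))`. [cite: MochizukiEtTh2009, Cor 2.19(ii) p.64] -/
noncomputable def pOf (M : E) : ℤ := Multiplicative.toAdd (py ((α M (SemidirectProduct.inr yv)).right : P))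

/-- The `z`-coordinate `r_M` of `α_M(s^alg(0,1,0))`. [cite: MochizukiEtTh2009, Cor 2.19(ii) p.64] -/
noncomputable def rOf (M : E) : ℤ := Multiplicative.toAdd (pz ((α M (SemidirectProduct.inr yv)).right : P))

/-- `py` of the probe image is `ofAdd p_M`. [cite: MochizukiEtTh2009, Cor 2.19(ii) p.64] -/
theorem py_probe (M : E) : py ((α M (SemidirectProduct.inr yv)).right : P) =
    Multiplicative.ofAdd (pOf h1 hcof htot α M) := (ofAdd_toAdd _).symm

/-- **Compatibility with the twisted transitions forces `p_{M'} = p_M` and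
`r_M = r_{M'} + (k_M - k_{M'}) · p_{M'}`** (the shears act on the `z`-coordinate).
[cite: MochizukiEtTh2009, Cor 2.19(ii) p.64] -/
theorem pOf_rOf_of_compat {x : ∀ M : E, ZMod (M : ℕ+)}
    {hx : ∀ (M M' : E) (h : (M : ℕ+) ∣ M'), ZMod.castHom (PNat.dvd_iff.mp h) (ZMod (M : ℕ+)) (x M') = x M}
    (hred : ∀ (M M' : E) (h : (M : ℕ+) ∣ M') (y : ((toy h1 hcof htot).level M').env),
      (system h1 hcof htot x hx).a M M' h ((toy h1 hcof htot).redEnv M M' h (α M' y)) =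
        α M ((toy h1 hcof htot).redEnv M M' h y))
    (M M' : E) (h : (M : ℕ+) ∣ M') :
    pOf h1 hcof htot α M' = pOf h1 hcof htot α M ∧
      rOf h1 hcof htot α M = rOf h1 hcof htot α M' + (lift x M - lift x M') * pOf h1 hcof htot α M' := by
  have key0 := hred M M' h (SemidirectProduct.inr yv)
  rw [redEnv_inr_yv] at key0
  have key := congrArg (fun w => ((SemidirectProduct.right w : PiY0) : P)) key0
  simp only [system_a_apply, redEnv_right, coe_shearY] at key
  -- key : shear (k_M - k_{M'}) (α_{M'} y).right = (α_M y).right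
  constructor
  · have := congrArg py key
    rw [py_shear] at this
    exact congrArg Multiplicative.toAdd this
  · have := congrArg pz key
    rw [pz_shear] at this
    have := congrArg Multiplicative.toAdd this
    rw [toAdd_mul, toAdd_zpow, smul_eq_mul] at this
    rw [rOf, rOf, ← this, pOf]

/-- **Automorphisms of the model at level `M` satisfy `M ∣ 2·r_M`** (and `p_M` is odd unless `M ∣ 2`):
`α_M` stabilises `Im(s^Θ) ∋ s^alg(0,2,0) = s^alg(0,1,0)²`; the cyclotome is characteristic
(torsion), so `α_M` conjugates `μ_M` through `inv^{p_M}`, which must be the inversion (`μ_M ∌`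
elements of order `> 2` fixed … unless `M ∣ 2`), i.e. `p_M` is odd; then the `μ_M`-component of
`α_M(s^alg(0,1,0))²` is trivial, while membership in `Im(s^Θ)` makes it `η_M(0, 2p_M, 2r_M)⁻¹ = -2r_M`.
[cite: MochizukiEtTh2009, Cor 2.19(ii) p.64] -/
theorem two_mul_rOf_of_iso
    (hiso : ∀ M : E, ∃ e : (((toy h1 hcof htot).level M).modelMono (eta_mem h1 hcof htot M)).Iso
      (((toy h1 hcof htot).level M).modelMono (eta_mem h1 hcof htot M)), e.e.toMulEquiv = α M)
    (M : E) :
    ((2 * rOf h1 hcof htot α M : ℤ) : ZMod (M : ℕ+)) = 0 ∧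
      (¬ ((M : ℕ+) : ℕ) ∣ 2 → Odd (pOf h1 hcof htot α M)) := by
  obtain ⟨e, he⟩ := hiso M
  -- (1) `α_M` stabilises `Im(s^Θ)`
  have hrange : ∀ g : PiYdd0, α M (((toy h1 hcof htot).level M).sTheta (eta_mem h1 hcof htot M) g) ∈
      (((toy h1 hcof htot).level M).sTheta (eta_mem h1 hcof htot M)).range := by
    intro g
    have hS := e.map_sTheta
    rw [he] at hS
    change (fun H => H.map (α M).toMonoidHom) ''
        muConjClass augY0 (chi M) (((toy h1 hcof htot).level M).sTheta (eta_mem h1 hcof htot M)).range =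
      muConjClass augY0 (chi M) (((toy h1 hcof htot).level M).sTheta (eta_mem h1 hcof htot M)).range at hS
    have hmem : (((toy h1 hcof htot).level M).sTheta (eta_mem h1 hcof htot M)).range.map
        (α M).toMonoidHom ∈ muConjClass augY0 (chi M)
          (((toy h1 hcof htot).level M).sTheta (eta_mem h1 hcof htot M)).range := by
      rw [← hS]
      exact ⟨_, self_mem_muConjClass _ _ _, rfl⟩
    obtain ⟨c, hc⟩ := hmem
    rw [map_conj_inMu_range_sTheta] at hc
    rw [← hc]
    exact Subgroup.mem_map_of_mem _ ⟨g, rfl⟩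
  -- notation
  set A : Env M := α M (SemidirectProduct.inr yv) with hA
  -- (2) `A² ∈ Im(s^Θ)`
  have h2 : A * A = α M (((toy h1 hcof htot).level M).sTheta (eta_mem h1 hcof htot M) ydd2) := by
    rw [hA, ← map_mul, ydd2, sTheta_two]; rfl
  obtain ⟨g₂, hg₂⟩ := hrange ydd2
  rw [← h2, sTheta_apply] at hg₂
  have hg₂r : (g₂ : P) = (A.right : P) * (A.right : P) :=
    congrArg (fun w => ((SemidirectProduct.right w : PiY0) : P)) hg₂
  have hg₂l : (eta M g₂)⁻¹ = A.left * chi M (py (A.right : P)) A.left :=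
    congrArg SemidirectProduct.left hg₂
  -- (3) the cyclotome is characteristic: `α_M(μ_M) ⊆ μ_M`
  set c₀ : Mu M := Multiplicative.ofAdd (1 : ZMod (M : ℕ+)) with hc₀
  set B : Env M := α M (inMu augY0 (chi M) c₀) with hB
  have hBr : B.right = 1 := by
    have hpow : (inMu augY0 (chi M) c₀ : Env M) ^ ((M : ℕ+) : ℕ) = 1 := by
      rw [← map_pow, hc₀, ← ofAdd_nsmul, Nat.smul_one_eq_cast, ZMod.natCast_self, ofAdd_zero, map_one]
    have h3 : SemidirectProduct.rightHom (α M ((inMu augY0 (chi M) c₀ : Env M) ^ ((M : ℕ+) : ℕ))) = 1 := by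
      rw [hpow, map_one, map_one]
    rw [map_pow, map_pow] at h3
    have h4 : ((B.right : PiY0) : P) ^ ((M : ℕ+) : ℕ) = 1 := by
      rw [← Subgroup.coe_pow, hB]
      exact congrArg Subtype.val h3
    exact Subtype.ext (eq_one_of_pow_eq_one (PNat.ne_zero M) h4)
  set b : Mu M := B.left with hb
  have hBeq : B = inMu augY0 (chi M) b := SemidirectProduct.ext rfl hBr
  -- (4) `α_M` conjugates `μ_M` through `χ_M(p_M)`, and `s^alg(0,1,0)` inverts `μ_M`: `χ_M(p_M) b = b⁻¹`
  have hconj := SemidirectProduct.inl_aut (φ := (chi M).comp augY0) yv c₀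
  have hφ : ((chi M).comp augY0) yv = inv M := chi_ofAdd_of_odd M odd_one
  rw [hφ, MulEquiv.inv_apply, map_inv, map_inv] at hconj
  -- hconj : (inl c₀)⁻¹ = inr yv * inl c₀ * (inr yv)⁻¹
  have hc2 := congrArg (α M) hconj
  rw [map_inv, map_mul, map_mul, map_inv] at hc2
  change B⁻¹ = A * B * A⁻¹ at hc2
  rw [hBeq, conj_inMu, ← map_inv] at hc2
  have hbinv : b⁻¹ = chi M (py (A.right : P)) b := SemidirectProduct.inl_injective hc2
  -- (5) `p_M` is odd unless `M ∣ 2`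
  have hodd : ¬ ((M : ℕ+) : ℕ) ∣ 2 → Odd (pOf h1 hcof htot α M) := by
    intro hM
    by_contra hev
    rw [Int.not_odd_iff_even] at hev
    rw [py_probe, chi_ofAdd_of_even M hev, MulAut.one_apply] at hbinv
    have hbb : b * b = 1 := inv_eq_iff_mul_eq_one.1 hbinv
    have hBB : B * B = 1 := by rw [hBeq, ← map_mul, hbb, map_one]
    have hcc : inMu augY0 (chi M) (c₀ * c₀) = (1 : Env M) :=
      (α M).injective (by rw [map_mul, map_mul, map_one]; exact hBB)
    have hc : c₀ * c₀ = 1 := SemidirectProduct.inl_injective (hcc.trans (map_one _).symm)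
    rw [hc₀, ← ofAdd_add, ofAdd_eq_one, one_add_one_eq_two] at hc
    apply hM
    have h2 : ((2 : ℤ) : ZMod ((M : ℕ+) : ℕ)) = 0 := by exact_mod_cast hc
    exact Int.natCast_dvd_natCast.1 ((ZMod.intCast_zmod_eq_zero_iff_dvd 2 _).1 h2)
  refine ⟨?_, hodd⟩
  by_cases hM : ((M : ℕ+) : ℕ) ∣ 2
  · rw [ZMod.intCast_zmod_eq_zero_iff_dvd]
    exact dvd_mul_of_dvd_left (Int.natCast_dvd_natCast.2 hM) _
  · -- (6) `p_M` odd: the `μ_M`-component of `A²` is trivial, and `A² ∈ Im(s^Θ)` reads `η_M(g₂) = 1`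
    have hφA : chi M (py (A.right : P)) = inv M := by rw [py_probe, chi_ofAdd_of_odd M (hodd hM)]
    rw [hφA, MulEquiv.inv_apply, mul_inv_cancel, inv_eq_one, eta_apply, hg₂r, map_mul, castM_apply,
      toAdd_mul, ofAdd_eq_one] at hg₂l
    rw [two_mul]
    exact hg₂l

end Extraction

/-! ## §9. The endgame: `2p · x` is integral, hence so is `x` — contradiction -/

/-- Over a cofinal index set, a compatible family of residues `x_M ∈ ℤ/M` with `q · x_M = n` for fixed
integers `q ≠ 0`, `n` and all `M` is integral (`lim ℤ/M` is torsion-free modulo `ℤ`).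
[cite: MochizukiEtTh2009, Rmk 2.16.1(iii) p.56] -/
theorem integral_of_mul_eq (hcof : ∀ n : ℕ+, ∃ M ∈ E, n ∣ M) (x : ∀ M : E, ZMod (M : ℕ+))
    (hx : ∀ (M M' : E) (h : (M : ℕ+) ∣ M'), ZMod.castHom (PNat.dvd_iff.mp h) (ZMod (M : ℕ+)) (x M') = x M)
    (q n : ℤ) (hq : q ≠ 0) (hrel : ∀ M : E, (q : ZMod (M : ℕ+)) * x M = n) :
    ∃ m : ℤ, ∀ M : E, (m : ZMod (M : ℕ+)) = x M := by
  have hqpos : 0 < q.natAbs := Int.natAbs_pos.2 hq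
  -- `q ∣ n`: read the relation at a level divisible by `q`
  obtain ⟨M₀, hM₀E, hqM₀⟩ := hcof ⟨q.natAbs, hqpos⟩
  have hqn : q ∣ n := by
    have h0 := hrel ⟨M₀, hM₀E⟩
    obtain ⟨k₀, hk₀⟩ := ZMod.intCast_surjective (x ⟨M₀, hM₀E⟩)
    rw [← hk₀, ← Int.cast_mul, ZMod.intCast_eq_intCast_iff_dvd_sub] at h0
    have hq' : q ∣ ((M₀ : ℕ) : ℤ) :=
      Int.natAbs_dvd.1 (Int.natCast_dvd_natCast.2 (PNat.dvd_iff.1 hqM₀))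
    have := dvd_add (hq'.trans h0) (dvd_mul_right q k₀)
    rwa [sub_add_cancel] at this
  obtain ⟨m, rfl⟩ := hqn
  refine ⟨m, fun M => ?_⟩
  obtain ⟨M', hM'E, hM'⟩ := hcof (⟨q.natAbs, hqpos⟩ * M)
  have hMM' : (M : ℕ+) ∣ M' := (dvd_mul_left (M : ℕ+) _).trans hM'
  obtain ⟨k', hk'⟩ := ZMod.intCast_surjective (x ⟨M', hM'E⟩)
  have h1 := hrel ⟨M', hM'E⟩
  rw [← hk', ← Int.cast_mul, ZMod.intCast_eq_intCast_iff_dvd_sub, ← mul_sub] at h1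
  -- h1 : (M' : ℤ) ∣ q * (m - k')
  have h2 : ((q.natAbs * (M : ℕ+) : ℕ) : ℤ) ∣ q * (m - k') := by
    refine (Int.natCast_dvd_natCast.2 ?_).trans h1
    exact_mod_cast PNat.dvd_iff.1 hM'
  have h3 : ((M : ℕ+) : ℤ) ∣ m - k' := by
    have h4 := Int.natAbs_dvd_natAbs.2 h2
    rw [Int.natAbs_natCast, Int.natAbs_mul] at h4
    exact Int.natCast_dvd.2 (Nat.dvd_of_mul_dvd_mul_left hqpos h4)
  rw [← hx M ⟨M', hM'E⟩ hMM', ← hk', map_intCast, ZMod.intCast_eq_intCast_iff_dvd_sub]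
  have := dvd_neg.2 h3
  rwa [neg_sub] at this

/-- **`Cor219_ii` FAILS at the inversion-twisted toy tower** (any admissible `E`): the twisted system
attached to a NON-INTEGRAL compatible family `x` (Rmk 2.16.1 (iii), `exists_compatible_family_not_integral`)
is not isomorphic to the natural one — a straightening `(α_M)_M` would give `p_M = p` odd,
`2 r_M = n + 2p·k_M` and `M ∣ 2 r_M`, i.e. `2p · x = -n` in `lim ℤ/M`, forcing `x` to be integral.
[cite: MochizukiEtTh2009, Cor 2.19(ii) p.64] -/
theorem not_cor219_ii : ¬ (toy h1 hcof htot).Cor219_ii := by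
  intro hC
  obtain ⟨x, hx, hxint⟩ := exists_compatible_family_not_integral (E := E) hcof
  obtain ⟨α, hiso, hred⟩ := hC (system h1 hcof htot x hx)
  apply hxint
  set I : E := ⟨1, h1⟩ with hI
  have hpM : ∀ M : E, pOf h1 hcof htot α M = pOf h1 hcof htot α I :=
    fun M => (pOf_rOf_of_compat h1 hcof htot α hred I M (one_dvd _)).1
  have hrM : ∀ M : E, rOf h1 hcof htot α I =
      rOf h1 hcof htot α M + (lift x I - lift x M) * pOf h1 hcof htot α M :=
    fun M => (pOf_rOf_of_compat h1 hcof htot α hred I M (one_dvd _)).2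
  -- `p` is odd: read it at a level divisible by `3`
  obtain ⟨M₃, hM₃E, h3⟩ := hcof 3
  have hM₃ : ¬ ((M₃ : ℕ) ∣ 2) := fun h => by
    have : (3 : ℕ) ∣ 2 := (PNat.dvd_iff.1 h3).trans h
    omega
  have hodd : Odd (pOf h1 hcof htot α I) :=
    hpM ⟨M₃, hM₃E⟩ ▸ (two_mul_rOf_of_iso h1 hcof htot α hiso ⟨M₃, hM₃E⟩).2 hM₃
  have hp0 : (2 * pOf h1 hcof htot α I : ℤ) ≠ 0 := by
    intro h0
    obtain ⟨k, hk⟩ := hodd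
    omega
  refine integral_of_mul_eq hcof x hx (2 * pOf h1 hcof htot α I)
    (2 * pOf h1 hcof htot α I * lift x I - 2 * rOf h1 hcof htot α I) hp0 fun M => ?_
  have h0 := (two_mul_rOf_of_iso h1 hcof htot α hiso M).1
  rw [← cast_lift x M, ← Int.cast_mul,
    show 2 * pOf h1 hcof htot α I * lift x M = 2 * rOf h1 hcof htot α M +
        (2 * pOf h1 hcof htot α I * lift x I - 2 * rOf h1 hcof htot α I) by
      rw [hrM M, hpM M]; ring,
    Int.cast_add, h0, zero_add]

/-- **The universal closure of the schema `ThetaEnvTower.Cor219_ii` is FALSE**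
(FACT-LIST row F-0649: instance-only). [cite: MochizukiEtTh2009, Cor 2.19(ii) p.64] -/
theorem not_forall_cor219_ii : ¬ ∀ (E : Set ℕ+) (T : ThetaEnvTower.{0} E), T.Cor219_ii :=
  fun h => not_cor219_ii one_mem_facLevels facLevels_cofinal facLevels_total (h _ _)

end InvToy

end ThetaEnvTower

end Literature.AnabelianGeometry.EtaleTheta
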